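import Literature.NumberTheory.ConnesConsani2021.ArchKernelL1Certificate
import HarnessLib

/-!
# The `L¹` panel frame on the additive scale `v = log ρ` (Tier-2 interface of the (E-a) enclosure)

RH-FREE corpus literature (label, line 1): elementary real-analysis bookkeeping (a sum over panels of
the additive variable `v ∈ [0, log 2]`); nothing in this file mentions `ζ`, the critical strip or RH,
and nothing here bears on the truth of RH.  bears_on (cell rh-crit, corpus C1): apex input (C) —
route «ConnesConsaniSemilocal» item K3 `WindowSpectralBound` (stmt 19306), whose one remaining
literature input is the (E-a) `L¹` enclosure `∫_{[−log 2, log 2]} |τ_c − ϖ| ≤ 1/400` of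
`CC2021_section6_enclosures` (`ArchKernelL1Frame.lean`: `section6_enclosures_iff_L1`).

STATUS (cell rulings, 2026-08-26): cc-lead R110 (i) / R111 / R112 (P3) — the Tier-2 kernel
certificate (seats cc-eng-1 g2 + cc-iso g4) works on panels of the ADDITIVE scale `v` (Taylor models
of `2ẽ·Re τ_c(v)` and of `S₈(e^v) = Σ_{n<8} τ(n)T_n(e^v)` re-centred on sub-panels, `m ≈ 2000`);
this file restates the multiplicative-scale frame `setIntegral_Icc_norm_sub_le_of_panels`
(`ArchKernelL1PanelFrame.lean`) and its corollaries `section6_enclosures_of_panels[_of_majorant]`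
(`ArchKernelL1Certificate.lean`) with the panel chain `0 = v₀ ≤ v₁ ≤ … ≤ v_m = log 2` and the exact
weights `v_{k+1} − v_k` (CC: "passing to the additive scale", §5 eq. (101) p. 33), plus the
uniform-grid specialisation `v_k = k·log 2/m` whose closing inequality is purely rational once an
upper bound `log 2 ≤ L⁺` is supplied.  It proves none of the Tier-2 obligations.

## What is here (all PROVED; 0 definitions, 0 named facts, no numerics)

* `setIntegral_Icc_norm_sub_le_of_vpanels` — THE ADDITIVE FRAME: continuous real even `τ` with
  `‖τ‖ ≤ B`, target `v ↦ S(e^{|v|})/(2e)`, slope enclosure `e, ẽ ∈ [e⁻, e⁺]`, truncation `|S − P| ≤ T`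
  on `[1,2]`, per-panel bounds `|2ẽ·Re τ(w) − P(e^w)| ≤ M_k` for `w ∈ [v_k, v_{k+1}]` give
  `∫_{[−log 2, log 2]} ‖τ − S(e^{|v|})/(2e)‖ ≤ e⁻⁻¹(Σ_k M_k (v_{k+1} − v_k) + (2(e⁺−e⁻)B + T)·log 2)`;
* `L1_prolateVarpi_le_of_vpanels`, `section6_enclosures_of_vpanels`,
  `section6_enclosures_of_vpanels_of_majorant` — the `ArchKernelL1Certificate` entry points with that
  panel hypothesis (`τ = τ_c`, `P = Σ_{n<N₁} τ(n)T_n`, tail from an index-wise majorant of `λ(n)`);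
* `section6_enclosures_of_uniformVpanels_of_majorant` — uniform grid
  `v_k = k·log 2/m`, closing check `L⁺·e⁻⁻¹((Σ_k M_k)/m + 2(e⁺−e⁻)B + T) ≤ ε₁` with `log 2 ≤ L⁺`;
  `section6_enclosures_of_uniformVpanels_of_majorant_rat` — the same with all certificate numbers
  in `ℚ`, so the closing check is decidable (`decide` / `norm_num`);
* `sum_range_eq_sum_map_range` — `Σ_{k<m} M k` as a `List` sum (the kernel's fold currency).

Source: A. Connes, C. Consani, *Weil positivity and trace formula, the archimedean place*, Selecta
Math. (N.S.) 27 (2021) 77 = arXiv:2006.13771 [bib `ConnesConsani2021`], §6.3–6.4 p. 24 (the kernel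
`ϖ`, Fact 6.1 "`‖τ − ϖ‖₁ ≤ ε₁` … (computer calculation)", Lemma 6.3), §5 eq. (101) p. 33 (additive
scale), App. F Lemma F.1 (arXiv Lemma 49) p. 55 (the tail).

WHAT THIS FILE IS NOT: a certificate, an enclosure of `ϖ`, a discharge of (E-a), or anything about RH.
-/

noncomputable section

open Real Set MeasureTheory Filter Topology

namespace Literature.NumberTheory.ConnesConsani2021

open Literature.NumberTheory.LFunctions

/-! ## The additive-scale panel frame -/

/-- Along a monotone chain `v 0 ≤ v 1 ≤ … ≤ v m`, every `v k` (`k ≤ m`) lies between the ends. [folklore] -/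
private theorem vchain_mem_Icc {v : ℕ → ℝ} {m : ℕ} (hmono : ∀ k < m, v k ≤ v (k + 1)) {k : ℕ}
    (hk : k ≤ m) : v 0 ≤ v k ∧ v k ≤ v m := by
  constructor
  · induction k with
    | zero => exact le_rfl
    | succ j ih => exact (ih (by omega)).trans (hmono j (by omega))
  · induction hk with
    | refl => exact le_rfl
    | step hle ih => exact ih (fun i hi ↦ hmono i (by omega)) |>.trans (hmono _ (by omega))

/-- RH-FREE. **The `L¹` panel frame on the additive scale.**  Let `τ : ℝ → ℂ` be continuous, real
(`im τ = 0`), even and bounded by `B`; let the target have the printed shape `v ↦ S(e^{|v|})/(2e)`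
(`ϖ = (Qε)(e^{|v|})/(2ε′(1₊))`, §6.3 p. 24) with `S` continuous on `[1,2]`, a slope enclosure
`e, ẽ ∈ [e⁻, e⁺]`, `0 < e⁻`, a uniform truncation bound `|S − P| ≤ T` on `[1,2]` and per-panel bounds
`|2ẽ·Re τ(w) − P(e^w)| ≤ M_k` for `w ∈ [v_k, v_{k+1}]`, `0 = v₀ ≤ … ≤ v_m = log 2`.  Then
`∫_{[−log 2, log 2]} ‖τ(v) − S(e^{|v|})/(2e)‖ dv ≤ e⁻⁻¹ (Σ_{k<m} M_k (v_{k+1} − v_k) + (2(e⁺−e⁻)B + T)·log 2)`.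
(Evenness halves the window; on the `k`-th panel `|2eτ − S| ≤ |2ẽτ − P| + 2|e−ẽ||τ| + |P − S|`;
`Σ_k (v_{k+1} − v_k) = log 2`.)  The per-panel bounds, `T` and `[e⁻, e⁺]` are the obligations of the
Tier-2 kernel certificate.
[cite: ConnesConsani2021, §6.4 Fact 6.1 + Lemma 6.3 p. 24; §6.3 p. 24; §5 eq. (101) p. 33] -/
theorem setIntegral_Icc_norm_sub_le_of_vpanels
    {τ : ℝ → ℂ} {S P : ℝ → ℝ} {e elo ehi et T B : ℝ} {m : ℕ} {v M : ℕ → ℝ}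
    (hτc : Continuous τ) (hτim : ∀ w, (τ w).im = 0) (hτev : ∀ w, τ (-w) = τ w)
    (hτB : ∀ w, ‖τ w‖ ≤ B) (hSc : ContinuousOn S (Icc 1 2))
    (helo : 0 < elo) (he : elo ≤ e ∧ e ≤ ehi) (het : elo ≤ et ∧ et ≤ ehi)
    (hT : ∀ ρ ∈ Icc (1 : ℝ) 2, |S ρ - P ρ| ≤ T)
    (hv0 : v 0 = 0) (hvm : v m = Real.log 2) (hmono : ∀ k < m, v k ≤ v (k + 1))
    (hM : ∀ k < m, ∀ w ∈ Icc (v k) (v (k + 1)), |2 * et * (τ w).re - P (Real.exp w)| ≤ M k) :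
    ∫ w in Icc (-Real.log 2) (Real.log 2), ‖τ w - (((S (Real.exp |w|) / (2 * e) : ℝ)) : ℂ)‖
      ≤ (1 / elo) * (∑ k ∈ Finset.range m, M k * (v (k + 1) - v k)
          + (2 * (ehi - elo) * B + T) * Real.log 2) := by
  -- Notation: the integrand `g`, the constants
  set L : ℝ := Real.log 2 with hL
  have hL0 : 0 < L := Real.log_pos one_lt_two
  have he0 : 0 < e := lt_of_lt_of_le helo he.1
  have hB0 : 0 ≤ B := le_trans (norm_nonneg _) (hτB 0)
  set g : ℝ → ℝ := fun w ↦ ‖τ w - (((S (Real.exp |w|) / (2 * e) : ℝ)) : ℂ)‖ with hg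
  -- `g` is even and equals `|Re τ − S(e^{|w|})/(2e)|`
  have hg_even : ∀ w, g (-w) = g w := by
    intro w; simp only [hg, hτev, abs_neg]
  have hg_re : ∀ w, g w = |(τ w).re - S (Real.exp |w|) / (2 * e)| := by
    intro w
    have hτw : τ w - (((S (Real.exp |w|) / (2 * e) : ℝ)) : ℂ)
        = ((((τ w).re - S (Real.exp |w|) / (2 * e) : ℝ)) : ℂ) := by
      apply Complex.ext <;> simp [hτim w]
    simp only [hg]
    rw [hτw, Complex.norm_real, Real.norm_eq_abs]
  -- continuity of `g` on `[−L, L]` (there `e^{|w|} ∈ [1,2]`)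
  have hexp_mem : ∀ w ∈ Icc (-L) L, Real.exp |w| ∈ Icc (1 : ℝ) 2 := by
    intro w hw
    refine ⟨Real.one_le_exp (abs_nonneg w), ?_⟩
    have h1 : |w| ≤ L := abs_le.2 ⟨hw.1, hw.2⟩
    calc Real.exp |w| ≤ Real.exp L := Real.exp_le_exp.2 h1
      _ = 2 := by rw [hL, Real.exp_log two_pos]
  have hgc : ContinuousOn g (Icc (-L) L) := by
    have h1 : ContinuousOn (fun w ↦ S (Real.exp |w|)) (Icc (-L) L) :=
      hSc.comp (by fun_prop) hexp_mem
    have h2 : ContinuousOn (fun w ↦ τ w - (((S (Real.exp |w|) / (2 * e) : ℝ)) : ℂ)) (Icc (-L) L) :=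
      hτc.continuousOn.sub (Complex.continuous_ofReal.comp_continuousOn (h1.div_const _))
    exact h2.norm
  -- Step 1: the set integral is an interval integral, and evenness halves it
  have hgi_l : IntervalIntegrable g volume (-L) 0 :=
    (hgc.mono (Icc_subset_Icc le_rfl hL0.le)).intervalIntegrable_of_Icc (by linarith)
  have hgi_r : IntervalIntegrable g volume 0 L :=
    (hgc.mono (Icc_subset_Icc (by linarith) le_rfl)).intervalIntegrable_of_Icc hL0.le
  have hstep1 : ∫ w in Icc (-L) L, g w = 2 * ∫ w in (0 : ℝ)..L, g w := by
    rw [integral_Icc_eq_integral_Ioc, ← intervalIntegral.integral_of_le (by linarith),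
      ← intervalIntegral.integral_add_adjacent_intervals hgi_l hgi_r]
    have hneg : ∫ w in (-L)..0, g w = ∫ w in (0 : ℝ)..L, g w := by
      have h1 : ∫ w in (0 : ℝ)..L, g (-w) = ∫ w in (-L)..(-0), g w := intervalIntegral.integral_comp_neg g
      rw [neg_zero] at h1
      rw [← h1]
      exact intervalIntegral.integral_congr fun w _ ↦ hg_even w
    rw [hneg]
    ring
  -- Step 2: the pointwise bound on the `k`-th panel
  set C : ℕ → ℝ := fun k ↦ (M k + 2 * (ehi - elo) * B + T) / (2 * elo) with hC
  have hpanel : ∀ k < m, ∀ w ∈ Icc (v k) (v (k + 1)), g w ≤ C k := by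
    intro k hk w hw
    have hvk : 0 ≤ v k := by rw [← hv0]; exact (vchain_mem_Icc hmono hk.le).1
    have hvk1 : v (k + 1) ≤ L := by rw [← hvm]; exact (vchain_mem_Icc hmono (by omega)).2
    have hw0 : 0 ≤ w := hvk.trans hw.1
    have hwL : w ≤ L := hw.2.trans hvk1
    set ρ : ℝ := Real.exp w with hρ
    have hρ1 : 1 ≤ ρ := Real.one_le_exp hw0
    have hρ2 : ρ ≤ 2 := by
      calc ρ = Real.exp w := rfl
        _ ≤ Real.exp L := Real.exp_le_exp.2 hwL
        _ = 2 := by rw [hL, Real.exp_log two_pos]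
    have hexp : Real.exp |w| = ρ := by rw [abs_of_nonneg hw0]
    rw [hg_re, hexp]
    simp only [hC]
    set t := (τ w).re with ht
    have htB : |t| ≤ B := (Complex.abs_re_le_norm _).trans (hτB _)
    have h1 := hM k hk w hw
    have h2 := hT ρ ⟨hρ1, hρ2⟩
    have hMk : 0 ≤ M k := le_trans (abs_nonneg _) h1
    have hT0 : 0 ≤ T := le_trans (abs_nonneg _) h2
    have hδ : 0 ≤ ehi - elo := by linarith [he.1, he.2]
    have h2e : 0 < 2 * e := by linarith
    have h2elo : 0 < 2 * elo := by linarith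
    -- `|t − S/(2e)| = |2e t − S| / (2e)`
    have hkey : |t - S ρ / (2 * e)| = |2 * e * t - S ρ| / (2 * e) := by
      rw [show t - S ρ / (2 * e) = (2 * e * t - S ρ) / (2 * e) by field_simp]
      rw [abs_div, abs_of_pos h2e]
    rw [hkey, div_le_div_iff₀ h2e h2elo]
    -- `|2et − S| ≤ |2ẽt − P| + 2|e − ẽ||t| + |P − S|`
    have htri : |2 * e * t - S ρ| ≤ |2 * et * t - P ρ| + 2 * |e - et| * |t| + |S ρ - P ρ| := by
      have e1 : 2 * e * t - S ρ = (2 * et * t - P ρ) + 2 * (e - et) * t + (P ρ - S ρ) := by ring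
      rw [e1]
      refine (abs_add_three _ _ _).trans ?_
      rw [abs_mul, abs_mul, abs_two, abs_sub_comm (P ρ) (S ρ)]
    have heet : |e - et| ≤ ehi - elo :=
      abs_sub_le_iff.2 ⟨by linarith [he.2, het.1], by linarith [he.1, het.2]⟩
    have hmid : 2 * |e - et| * |t| ≤ 2 * (ehi - elo) * B :=
      mul_le_mul (mul_le_mul_of_nonneg_left heet zero_le_two) htB (abs_nonneg _)
        (mul_nonneg zero_le_two hδ)
    have hsum0 : 0 ≤ M k + 2 * (ehi - elo) * B + T :=
      add_nonneg (add_nonneg hMk (mul_nonneg (mul_nonneg zero_le_two hδ) hB0)) hT0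
    calc |2 * e * t - S ρ| * (2 * elo)
        ≤ (M k + 2 * (ehi - elo) * B + T) * (2 * elo) := by
          refine mul_le_mul_of_nonneg_right ?_ h2elo.le
          linarith [htri, h1, h2, hmid]
      _ ≤ (M k + 2 * (ehi - elo) * B + T) * (2 * e) :=
          mul_le_mul_of_nonneg_left (by linarith [he.1]) hsum0
  -- Step 3: split `[0, L]` along the panels and bound each piece
  have hgi : ∀ k < m, IntervalIntegrable g volume (v k) (v (k + 1)) := by
    intro k hk
    have hvk : 0 ≤ v k := by rw [← hv0]; exact (vchain_mem_Icc hmono hk.le).1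
    have hvk1 : v (k + 1) ≤ L := by rw [← hvm]; exact (vchain_mem_Icc hmono (by omega)).2
    exact (hgc.mono (Icc_subset_Icc (by linarith) hvk1)).intervalIntegrable_of_Icc (hmono k hk)
  have hsplit : ∫ w in (0 : ℝ)..L, g w = ∑ k ∈ Finset.range m, ∫ w in v k..v (k + 1), g w := by
    rw [← hv0, ← hvm]
    exact (intervalIntegral.sum_integral_adjacent_intervals hgi).symm
  have hpiece : ∀ k ∈ Finset.range m,
      ∫ w in v k..v (k + 1), g w ≤ C k * (v (k + 1) - v k) := by
    intro k hk
    rw [Finset.mem_range] at hk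
    have hle : v k ≤ v (k + 1) := hmono k hk
    calc ∫ w in v k..v (k + 1), g w
        ≤ ∫ w in v k..v (k + 1), C k :=
          intervalIntegral.integral_mono_on hle (hgi k hk) intervalIntegrable_const
            fun w hw ↦ hpanel k hk w hw
      _ = C k * (v (k + 1) - v k) := by
          rw [intervalIntegral.integral_const, smul_eq_mul, mul_comm]
  -- Step 4: assemble
  have hsum_le : ∑ k ∈ Finset.range m, ∫ w in v k..v (k + 1), g w
      ≤ ∑ k ∈ Finset.range m, C k * (v (k + 1) - v k) := Finset.sum_le_sum hpiece
  -- `Σ C_k Δ_k = (2e⁻)⁻¹ (Σ M_k Δ_k + (2δB + T) Σ Δ_k)` and `Σ Δ_k = log 2`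
  have hΔ_sum : ∑ k ∈ Finset.range m, (v (k + 1) - v k) = L := by
    rw [Finset.sum_range_sub, hvm, hv0, sub_zero]
  have hCsum : ∑ k ∈ Finset.range m, C k * (v (k + 1) - v k)
      = (1 / (2 * elo)) * (∑ k ∈ Finset.range m, M k * (v (k + 1) - v k)
          + (2 * (ehi - elo) * B + T) * L) := by
    have hpt : ∀ k ∈ Finset.range m, C k * (v (k + 1) - v k)
        = (1 / (2 * elo)) * (M k * (v (k + 1) - v k)
            + (2 * (ehi - elo) * B + T) * (v (k + 1) - v k)) := by
      intro k _
      simp only [hC]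
      field_simp
      ring
    rw [Finset.sum_congr rfl hpt, ← Finset.mul_sum, Finset.sum_add_distrib, ← Finset.mul_sum, hΔ_sum]
  -- put everything together
  calc ∫ w in Icc (-L) L, g w
      = 2 * ∫ w in (0 : ℝ)..L, g w := hstep1
    _ = 2 * ∑ k ∈ Finset.range m, ∫ w in v k..v (k + 1), g w := by rw [hsplit]
    _ ≤ 2 * ((1 / (2 * elo)) * (∑ k ∈ Finset.range m, M k * (v (k + 1) - v k)
          + (2 * (ehi - elo) * B + T) * L)) := by
        rw [← hCsum]
        exact mul_le_mul_of_nonneg_left hsum_le zero_le_two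
    _ = (1 / elo) * (∑ k ∈ Finset.range m, M k * (v (k + 1) - v k)
          + (2 * (ehi - elo) * B + T) * L) := by
        field_simp

/-! ## The `ArchKernelL1Certificate` entry points on the additive scale -/

/-- RH-FREE. **The one (E-a) inequality from an additive-scale panel certificate** — the frame
`setIntegral_Icc_norm_sub_le_of_vpanels` at `τ = τ_c` (the certificate kernel, real, even:
`SpectralCert.frameKernel_im/_neg`), `S = Σ' τ(n)T_n` (series (97)), `e = Σ' t(n)` (Lemma 5.4), so that
`S(e^{|v|})/(2e) = prolateVarpi v`; the per-panel hypothesis reads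
`|2ẽ·Re τ_c(w) − Σ_{n<N₁} τ(n)T_n(e^w)| ≤ M_k` for `w ∈ [v_k, v_{k+1}]`.
[cite: ConnesConsani2021, §6.4 Fact 6.1 + Lemma 6.3 p. 24; §6.3 p. 24; §5 eq. (101) p. 33] -/
theorem L1_prolateVarpi_le_of_vpanels {elo ehi et T B : ℝ} {m N₁ : ℕ} {v M : ℕ → ℝ}
    (hB : ∀ w, ‖SpectralCert.frameKernel (-(Real.log 2 / 2)) (Real.log 2 / 2) SpectralCert.CertAF.N
        (fun n ↦ (SpectralCert.CertAF.c n : ℝ)) w‖ ≤ B)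
    (helo : 0 < elo)
    (he : elo ≤ ∑' n : ℕ, epsSlopeTerm (prolateFun n) ∧ ∑' n : ℕ, epsSlopeTerm (prolateFun n) ≤ ehi)
    (het : elo ≤ et ∧ et ≤ ehi)
    (hT : ∀ ρ ∈ Icc (1 : ℝ) 2,
      |∑' n : ℕ, sonineQTerm (prolateFun n) (prolateEigen n) ρ
        - ∑ n ∈ Finset.range N₁, sonineQTerm (prolateFun n) (prolateEigen n) ρ| ≤ T)
    (hv0 : v 0 = 0) (hvm : v m = Real.log 2) (hmono : ∀ k < m, v k ≤ v (k + 1))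
    (hM : ∀ k < m, ∀ w ∈ Icc (v k) (v (k + 1)),
      |2 * et * (SpectralCert.frameKernel (-(Real.log 2 / 2)) (Real.log 2 / 2) SpectralCert.CertAF.N
            (fun n ↦ (SpectralCert.CertAF.c n : ℝ)) w).re
        - ∑ n ∈ Finset.range N₁, sonineQTerm (prolateFun n) (prolateEigen n) (Real.exp w)| ≤ M k) :
    ∫ w in Icc (-Real.log 2) (Real.log 2),
        ‖SpectralCert.frameKernel (-(Real.log 2 / 2)) (Real.log 2 / 2) SpectralCert.CertAF.N
            (fun n ↦ (SpectralCert.CertAF.c n : ℝ)) w - ((prolateVarpi w : ℝ) : ℂ)‖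
      ≤ (1 / elo) * (∑ k ∈ Finset.range m, M k * (v (k + 1) - v k)
          + (2 * (ehi - elo) * B + T) * Real.log 2) := by
  have h := setIntegral_Icc_norm_sub_le_of_vpanels
    (τ := SpectralCert.frameKernel (-(Real.log 2 / 2)) (Real.log 2 / 2) SpectralCert.CertAF.N
      (fun n ↦ (SpectralCert.CertAF.c n : ℝ)))
    (S := fun ρ : ℝ ↦ ∑' n : ℕ, sonineQTerm (prolateFun n) (prolateEigen n) ρ)
    (P := fun ρ : ℝ ↦ ∑ n ∈ Finset.range N₁, sonineQTerm (prolateFun n) (prolateEigen n) ρ)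
    (e := ∑' n : ℕ, epsSlopeTerm (prolateFun n))
    (SpectralCert.continuous_frameKernel _ _ _ _) (SpectralCert.frameKernel_im _ _ _ _)
    (SpectralCert.frameKernel_neg _ _ _ _) hB continuousOn_tsum_sonineQTerm_prolateFun helo he het hT
    hv0 hvm hmono hM
  simpa only [prolateVarpi_apply] using h

/-- RH-FREE. **`CC2021_section6_enclosures` from an additive-scale panel certificate** (the (E-b)
conjunct being the kernel theorem `SlopeCert.epsSlope_enclosure_holds`, and (E-a) the one inequality,
`section6_enclosures_iff_L1`): the finitely many Tier-2 obligations on the panels `[v_k, v_{k+1}]` of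
`[0, log 2]` plus ONE real inequality
`e⁻⁻¹(Σ_k M_k (v_{k+1}−v_k) + (2(e⁺−e⁻)B + T)·log 2) ≤ 1/400` give the whole named fact.
[cite: ConnesConsani2021, §6.4 Fact 6.1 + Lemma 6.3 p. 24; §5 eq. (101) p. 33; §6.7 Lemma 6.10 / Thm. 6.11 p. 28] -/
theorem section6_enclosures_of_vpanels {elo ehi et T B : ℝ} {m N₁ : ℕ} {v M : ℕ → ℝ}
    (hB : ∀ w, ‖SpectralCert.frameKernel (-(Real.log 2 / 2)) (Real.log 2 / 2) SpectralCert.CertAF.N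
        (fun n ↦ (SpectralCert.CertAF.c n : ℝ)) w‖ ≤ B)
    (helo : 0 < elo)
    (he : elo ≤ ∑' n : ℕ, epsSlopeTerm (prolateFun n) ∧ ∑' n : ℕ, epsSlopeTerm (prolateFun n) ≤ ehi)
    (het : elo ≤ et ∧ et ≤ ehi)
    (hT : ∀ ρ ∈ Icc (1 : ℝ) 2,
      |∑' n : ℕ, sonineQTerm (prolateFun n) (prolateEigen n) ρ
        - ∑ n ∈ Finset.range N₁, sonineQTerm (prolateFun n) (prolateEigen n) ρ| ≤ T)
    (hv0 : v 0 = 0) (hvm : v m = Real.log 2) (hmono : ∀ k < m, v k ≤ v (k + 1))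
    (hM : ∀ k < m, ∀ w ∈ Icc (v k) (v (k + 1)),
      |2 * et * (SpectralCert.frameKernel (-(Real.log 2 / 2)) (Real.log 2 / 2) SpectralCert.CertAF.N
            (fun n ↦ (SpectralCert.CertAF.c n : ℝ)) w).re
        - ∑ n ∈ Finset.range N₁, sonineQTerm (prolateFun n) (prolateEigen n) (Real.exp w)| ≤ M k)
    (hcheck : (1 / elo) * (∑ k ∈ Finset.range m, M k * (v (k + 1) - v k)
        + (2 * (ehi - elo) * B + T) * Real.log 2) ≤ ((SpectralCert.CertAF.ε₁ : ℚ) : ℝ)) :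
    CC2021_section6_enclosures :=
  section6_enclosures_iff_L1.2
    ((L1_prolateVarpi_le_of_vpanels hB helo he het hT hv0 hvm hmono hM).trans hcheck)

/-- RH-FREE. **`CC2021_section6_enclosures` from an additive-scale panel certificate and a majorant**
— `section6_enclosures_of_vpanels` with its tail hypothesis supplied by
`abs_tsum_sub_sum_sonineQTerm_le_of_majorant` (App. F Lemma F.1 (i) packaging): Tier-2 obligations
(1) `‖τ_c‖ ≤ B`, (2) the slope enclosure, (3) the per-panel bounds for the modes `n < N₁` on the
additive panels `[v_k, v_{k+1}]`, (4) ONE numeral for the majorant tail and (5) the closing real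
inequality; the majorant `R` is a Tier-1 theorem — none of it is proved here.
[cite: ConnesConsani2021, §6.4 Fact 6.1 + Lemma 6.3 p. 24; App. F Lemma F.1 (i) p. 55; §5 eq. (101) p. 33; §6.7 Lemma 6.10 / Thm. 6.11 p. 28] -/
theorem section6_enclosures_of_vpanels_of_majorant {elo ehi et T B : ℝ} {m N₁ : ℕ} {v M : ℕ → ℝ}
    {R : ℕ → ℝ} (hN : 3 ≤ N₁)
    (hR : ∀ n, N₁ ≤ n → |prolateEigen n| ≤ R n) (hR' : ∀ n, N₁ ≤ n → R n ≤ 13 / 200)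
    (hRs : Summable (fun n ↦ R n * remainderPoly n))
    (hRT : ∑' k : ℕ, R (k + N₁) * (4 * π * remainderPoly (k + N₁)) ≤ T)
    (hB : ∀ w, ‖SpectralCert.frameKernel (-(Real.log 2 / 2)) (Real.log 2 / 2) SpectralCert.CertAF.N
        (fun n ↦ (SpectralCert.CertAF.c n : ℝ)) w‖ ≤ B)
    (helo : 0 < elo)
    (he : elo ≤ ∑' n : ℕ, epsSlopeTerm (prolateFun n) ∧ ∑' n : ℕ, epsSlopeTerm (prolateFun n) ≤ ehi)
    (het : elo ≤ et ∧ et ≤ ehi)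
    (hv0 : v 0 = 0) (hvm : v m = Real.log 2) (hmono : ∀ k < m, v k ≤ v (k + 1))
    (hM : ∀ k < m, ∀ w ∈ Icc (v k) (v (k + 1)),
      |2 * et * (SpectralCert.frameKernel (-(Real.log 2 / 2)) (Real.log 2 / 2) SpectralCert.CertAF.N
            (fun n ↦ (SpectralCert.CertAF.c n : ℝ)) w).re
        - ∑ n ∈ Finset.range N₁, sonineQTerm (prolateFun n) (prolateEigen n) (Real.exp w)| ≤ M k)
    (hcheck : (1 / elo) * (∑ k ∈ Finset.range m, M k * (v (k + 1) - v k)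
        + (2 * (ehi - elo) * B + T) * Real.log 2) ≤ ((SpectralCert.CertAF.ε₁ : ℚ) : ℝ)) :
    CC2021_section6_enclosures :=
  section6_enclosures_of_vpanels hB helo he het
    (fun _ hρ ↦ abs_tsum_sub_sum_sonineQTerm_le_of_majorant hN hR hR' hRs hRT hρ)
    hv0 hvm hmono hM hcheck

/-! ## The uniform grid `v_k = k · log 2 / m` -/

/-- On the uniform grid `v_k = k·L/m` the weighted sum is `(L/m)·Σ_k M_k`. [folklore] -/
private theorem sum_mul_uniformGrid_sub (M : ℕ → ℝ) (L : ℝ) (m : ℕ) :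
    ∑ k ∈ Finset.range m, M k * (((k + 1 : ℕ) : ℝ) * L / m - (k : ℝ) * L / m)
      = (∑ k ∈ Finset.range m, M k) * (L / m) := by
  rw [Finset.sum_mul]
  refine Finset.sum_congr rfl fun k _ ↦ ?_
  push_cast
  ring

/-- RH-FREE. `Σ_{k<m} M k` as the sum of the list `(List.range m).map M` — the fold by which the
kernel certificate evaluates the panel sum of the printed "computer calculation" behind Fact 6.1.
[cite: ConnesConsani2021, §6.4 Fact 6.1 p. 24 ("(computer calculation)")] -/
theorem sum_range_eq_sum_map_range (M : ℕ → ℝ) (m : ℕ) :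
    ∑ k ∈ Finset.range m, M k = ((List.range m).map M).sum := by
  rw [Finset.sum_eq_multiset_sum, Finset.range_val, Multiset.range, Multiset.map_coe, Multiset.sum_coe]

/-- RH-FREE. **`CC2021_section6_enclosures` from a UNIFORM additive-scale panel certificate and a
majorant**: panels `[k·log 2/m, (k+1)·log 2/m]`, `k < m` (`0 < m`), per-panel bounds `M_k`, and the
closing inequality in purely rational form through any upper bound `log 2 ≤ L⁺` (e.g. Mathlib's
`Real.log_two_lt_d9`): `L⁺ · e⁻⁻¹ · ((Σ_{k<m} M_k)/m + 2(e⁺−e⁻)B + T) ≤ ε₁ = 1/400`.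
[cite: ConnesConsani2021, §6.4 Fact 6.1 + Lemma 6.3 p. 24; App. F Lemma F.1 (i) p. 55; §5 eq. (101) p. 33; §6.7 Lemma 6.10 / Thm. 6.11 p. 28] -/
theorem section6_enclosures_of_uniformVpanels_of_majorant {elo ehi et T B Lhi : ℝ} {m N₁ : ℕ}
    {M : ℕ → ℝ} {R : ℕ → ℝ} (hN : 3 ≤ N₁)
    (hR : ∀ n, N₁ ≤ n → |prolateEigen n| ≤ R n) (hR' : ∀ n, N₁ ≤ n → R n ≤ 13 / 200)
    (hRs : Summable (fun n ↦ R n * remainderPoly n))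
    (hRT : ∑' k : ℕ, R (k + N₁) * (4 * π * remainderPoly (k + N₁)) ≤ T)
    (hB : ∀ w, ‖SpectralCert.frameKernel (-(Real.log 2 / 2)) (Real.log 2 / 2) SpectralCert.CertAF.N
        (fun n ↦ (SpectralCert.CertAF.c n : ℝ)) w‖ ≤ B)
    (helo : 0 < elo)
    (he : elo ≤ ∑' n : ℕ, epsSlopeTerm (prolateFun n) ∧ ∑' n : ℕ, epsSlopeTerm (prolateFun n) ≤ ehi)
    (het : elo ≤ et ∧ et ≤ ehi) (hm : 0 < m)
    (hM : ∀ k < m, ∀ w ∈ Icc ((k : ℝ) * Real.log 2 / m) (((k + 1 : ℕ) : ℝ) * Real.log 2 / m),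
      |2 * et * (SpectralCert.frameKernel (-(Real.log 2 / 2)) (Real.log 2 / 2) SpectralCert.CertAF.N
            (fun n ↦ (SpectralCert.CertAF.c n : ℝ)) w).re
        - ∑ n ∈ Finset.range N₁, sonineQTerm (prolateFun n) (prolateEigen n) (Real.exp w)| ≤ M k)
    (hL : Real.log 2 ≤ Lhi)
    (hcheck : Lhi * ((1 / elo) * ((∑ k ∈ Finset.range m, M k) / m + (2 * (ehi - elo) * B + T)))
        ≤ ((SpectralCert.CertAF.ε₁ : ℚ) : ℝ)) :
    CC2021_section6_enclosures := by
  set L : ℝ := Real.log 2 with hLdef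
  have hL0 : 0 < L := Real.log_pos one_lt_two
  have hm0 : (0 : ℝ) < m := by exact_mod_cast hm
  -- the grid
  set v : ℕ → ℝ := fun k ↦ (k : ℝ) * L / m with hv
  have hv0 : v 0 = 0 := by simp [hv]
  have hvm : v m = L := by simp only [hv]; field_simp
  have hmono : ∀ k < m, v k ≤ v (k + 1) := by
    intro k _
    simp only [hv]
    push_cast
    have h1 : (0 : ℝ) ≤ L / m := div_nonneg hL0.le hm0.le
    have h2 : ((k : ℝ) + 1) * L / m = (k : ℝ) * L / m + L / m := by ring
    linarith
  have hM' : ∀ k < m, ∀ w ∈ Icc (v k) (v (k + 1)),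
      |2 * et * (SpectralCert.frameKernel (-(Real.log 2 / 2)) (Real.log 2 / 2) SpectralCert.CertAF.N
            (fun n ↦ (SpectralCert.CertAF.c n : ℝ)) w).re
        - ∑ n ∈ Finset.range N₁, sonineQTerm (prolateFun n) (prolateEigen n) (Real.exp w)| ≤ M k := by
    intro k hk w hw
    exact hM k hk w (by simpa [hv] using hw)
  -- nonnegativity of the bracket, so that `log 2 ≤ L⁺` can be inserted
  have hB0 : 0 ≤ B := le_trans (norm_nonneg _) (hB 0)
  have hδ : 0 ≤ ehi - elo := by linarith [he.1, he.2]
  have hT0 : 0 ≤ T :=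
    le_trans (abs_nonneg _)
      (abs_tsum_sub_sum_sonineQTerm_le_of_majorant hN hR hR' hRs hRT (ρ := 1) ⟨le_rfl, one_le_two⟩)
  have hMk : ∀ k ∈ Finset.range m, 0 ≤ M k := by
    intro k hk
    rw [Finset.mem_range] at hk
    exact le_trans (abs_nonneg _) (hM' k hk (v k) (left_mem_Icc.2 (hmono k hk)))
  have hbr : 0 ≤ (1 / elo) * ((∑ k ∈ Finset.range m, M k) / m + (2 * (ehi - elo) * B + T)) := by
    have h1 : 0 ≤ ∑ k ∈ Finset.range m, M k := Finset.sum_nonneg hMk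
    positivity
  refine section6_enclosures_of_vpanels_of_majorant hN hR hR' hRs hRT hB helo he het hv0 hvm hmono hM' ?_
  -- the closing inequality
  have hsum : ∑ k ∈ Finset.range m, M k * (v (k + 1) - v k) = (∑ k ∈ Finset.range m, M k) * (L / m) := by
    simp only [hv]
    exact sum_mul_uniformGrid_sub M L m
  rw [hsum]
  calc (1 / elo) * ((∑ k ∈ Finset.range m, M k) * (L / m) + (2 * (ehi - elo) * B + T) * L)
      = L * ((1 / elo) * ((∑ k ∈ Finset.range m, M k) / m + (2 * (ehi - elo) * B + T))) := by
        field_simp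
    _ ≤ Lhi * ((1 / elo) * ((∑ k ∈ Finset.range m, M k) / m + (2 * (ehi - elo) * B + T))) :=
        mul_le_mul_of_nonneg_right hL hbr
    _ ≤ ((SpectralCert.CertAF.ε₁ : ℚ) : ℝ) := hcheck

/-- RH-FREE. **The same, with every certificate number RATIONAL** (`e⁻, e⁺, ẽ, T, B, L⁺ : ℚ`, the
per-panel bounds `M : ℕ → ℚ`), so that the closing inequality
`L⁺ · e⁻⁻¹ · ((Σ_{k<m} M_k)/m + 2(e⁺−e⁻)B + T) ≤ ε₁` is a DECIDABLE statement in `ℚ` (the kernel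
certificate closes it by `decide` / `norm_num`); all real-valued hypotheses carry the casts.
[cite: ConnesConsani2021, §6.4 Fact 6.1 + Lemma 6.3 p. 24; App. F Lemma F.1 (i) p. 55; §5 eq. (101) p. 33; §6.7 Lemma 6.10 / Thm. 6.11 p. 28] -/
theorem section6_enclosures_of_uniformVpanels_of_majorant_rat {elo ehi et T B Lhi : ℚ} {m N₁ : ℕ}
    {M : ℕ → ℚ} {R : ℕ → ℝ} (hN : 3 ≤ N₁)
    (hR : ∀ n, N₁ ≤ n → |prolateEigen n| ≤ R n) (hR' : ∀ n, N₁ ≤ n → R n ≤ 13 / 200)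
    (hRs : Summable (fun n ↦ R n * remainderPoly n))
    (hRT : ∑' k : ℕ, R (k + N₁) * (4 * π * remainderPoly (k + N₁)) ≤ (T : ℝ))
    (hB : ∀ w, ‖SpectralCert.frameKernel (-(Real.log 2 / 2)) (Real.log 2 / 2) SpectralCert.CertAF.N
        (fun n ↦ (SpectralCert.CertAF.c n : ℝ)) w‖ ≤ (B : ℝ))
    (helo : 0 < elo)
    (he : (elo : ℝ) ≤ ∑' n : ℕ, epsSlopeTerm (prolateFun n) ∧
      ∑' n : ℕ, epsSlopeTerm (prolateFun n) ≤ (ehi : ℝ))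
    (het : elo ≤ et ∧ et ≤ ehi) (hm : 0 < m)
    (hM : ∀ k < m, ∀ w ∈ Icc ((k : ℝ) * Real.log 2 / m) (((k + 1 : ℕ) : ℝ) * Real.log 2 / m),
      |2 * (et : ℝ) * (SpectralCert.frameKernel (-(Real.log 2 / 2)) (Real.log 2 / 2)
            SpectralCert.CertAF.N (fun n ↦ (SpectralCert.CertAF.c n : ℝ)) w).re
        - ∑ n ∈ Finset.range N₁, sonineQTerm (prolateFun n) (prolateEigen n) (Real.exp w)|
        ≤ (M k : ℝ))
    (hL : Real.log 2 ≤ (Lhi : ℝ))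
    (hcheck : Lhi * ((1 / elo) * ((∑ k ∈ Finset.range m, M k) / m + (2 * (ehi - elo) * B + T)))
        ≤ SpectralCert.CertAF.ε₁) :
    CC2021_section6_enclosures := by
  have helo' : (0 : ℝ) < (elo : ℝ) := by exact_mod_cast helo
  have het' : (elo : ℝ) ≤ (et : ℝ) ∧ (et : ℝ) ≤ (ehi : ℝ) :=
    ⟨by exact_mod_cast het.1, by exact_mod_cast het.2⟩
  refine section6_enclosures_of_uniformVpanels_of_majorant (M := fun k ↦ (M k : ℝ)) hN hR hR' hRs
    hRT hB helo' he het' hm hM hL ?_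
  have hc : ((Lhi * ((1 / elo) * ((∑ k ∈ Finset.range m, M k) / m + (2 * (ehi - elo) * B + T)))
      : ℚ) : ℝ) ≤ ((SpectralCert.CertAF.ε₁ : ℚ) : ℝ) := by exact_mod_cast hcheck
  push_cast at hc
  exact hc

end Literature.NumberTheory.ConnesConsani2021

end
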